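import Literature.MathematicalPhysics.QuantumLattice.HubbardRingPerronFrobeniusProofs
import Literature.MathematicalPhysics.QuantumLattice.HubbardCommutatorBound

/-!
# The one-particle (addition) cost of the Hubbard sector ground-state energies

Trunk T-QLATTICE (family `hubbard`); companion of `HubbardModelThermodynamicLimitProofs.lean` and
`HubbardRectangularTorus.lean`, written for the support item `TwPureThermalBound` of the route
`HubbardSuperconductivity/ThermalWedge`. The subadditivity (tiling) argument for the thermodynamic
limit of the sector ground-state energies `E_G(N) = groundEnergyAt G t U N` compares sectors whose
particle numbers differ by the rounding of the density, which needs a VOLUME-UNIFORM bound on the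
cost of adding one particle. This file proves it for the Hubbard Hamiltonian `H = hamiltonian G t U`
on any finite graph of maximal degree `≤ Δ`:

* `exists_unit_groundState` — every sector `N ≤ 2|Λ|` carries a normalised eigenvector of `H` with
  eigenvalue `E_G(N)` (`sector_groundState` on the coordinate subspace `nParticleSubmodule N`; `H`
  is block diagonal in `N`, `LiebThm1.preservesSectors_hamiltonian`);
* `groundEnergyAt_mul_norm_le` — the homogeneous variational bound `E_G(N) ⟨φ,φ⟩ ≤ Re⟨φ, Hφ⟩` on
  the `N`-sector;
* `sum_star_creation_mulVec_dotProduct`, `sum_star_annihilation_mulVec_dotProduct` —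
  `Σ_k ‖c†_k ψ‖² = 2|Λ| - N`, `Σ_k ‖c_k ψ‖² = N` for a unit vector of the `N`-sector (CAR);
* **`groundEnergyAt_succ_le`** — `E_G(N+1) ≤ E_G(N) + K · 2|Λ|/(2|Λ| - N)`, `N < 2|Λ|`, and
  **`groundEnergyAt_pred_le`** — `E_G(N-1) ≤ E_G(N) + K · 2|Λ|/N`, `1 ≤ N ≤ 2|Λ|`, with
  `K = 2(2Δ+1)(2|t| + |U|)`: averaging `⟨c†_kψ, H c†_kψ⟩ = E ‖c†_kψ‖² + ⟨c†_kψ, [H,c†_k]ψ⟩` (resp.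
  with `c_k`) over the `2|Λ|` orbitals with the volume-independent commutator bounds
  `‖[H, c^{(†)}_k]‖ ≤ K` of `HubbardCommutatorBound.lean` (graded locality). At densities in
  `[η, 2 - η]` these are `O(1/η)` Lipschitz constants in `N`, uniformly in the volume.

Generic helpers: `⟨Ax, y⟩ = ⟨x, Aᴴy⟩`, `|⟨a, Ab⟩| ≤ ‖a‖₂‖A‖‖b‖₂` for the `dotProduct` pairing and the
`ℓ²` operator norm. Everything is proved; no definition. [folklore]

## Sources

D. Ruelle, *Statistical Mechanics: Rigorous Results* (1969), §3.4 (a priori bounds and continuity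
of thermodynamic functions in the density — the classical analogue); H. Tasaki, *Physics and
Mathematics of Quantum Many-Body Systems* (2020), §2.1 (variational principle in finite volume);
O. Bratteli, D. W. Robinson, *Operator Algebras and QSM II*, §5.2.2 (CAR algebra).
-/

noncomputable section

open Matrix Finset
open scoped ComplexOrder BigOperators Matrix.Norms.L2Operator InnerProductSpace

namespace Literature.MathematicalPhysics.QuantumLattice

namespace ThermodynamicLimit

section Generic

variable {m : Type*} [Fintype m] [DecidableEq m]

omit [DecidableEq m] in
/-- `⟨A x, y⟩ = ⟨x, Aᴴ y⟩` for the `dotProduct` pairing. [folklore] -/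
theorem star_mulVec_dotProduct (A : Matrix m m ℂ) (x y : m → ℂ) :
    star (A *ᵥ x) ⬝ᵥ y = star x ⬝ᵥ (Aᴴ *ᵥ y) := by
  rw [dotProduct_mulVec, star_mulVec]

omit [DecidableEq m] in
/-- The `dotProduct` pairing is the Euclidean inner product. [folklore] -/
theorem star_dotProduct_eq_inner (a b : m → ℂ) :
    star a ⬝ᵥ b = ⟪(WithLp.toLp 2 a : EuclideanSpace ℂ m), WithLp.toLp 2 b⟫_ℂ := by
  rw [EuclideanSpace.inner_eq_star_dotProduct, dotProduct_comm]

omit [DecidableEq m] in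
/-- `‖a‖₂² = Re ⟨a, a⟩`. [folklore] -/
theorem norm_toLp_sq (a : m → ℂ) :
    ‖(WithLp.toLp 2 a : EuclideanSpace ℂ m)‖ ^ 2 = (star a ⬝ᵥ a).re := by
  rw [star_dotProduct_eq_inner, ← inner_self_eq_norm_sq (𝕜 := ℂ)]
  rfl

/-- `‖A b‖₂ ≤ ‖A‖ ‖b‖₂` (the `ℓ²` operator norm). [folklore] -/
theorem norm_toLp_mulVec_le (A : Matrix m m ℂ) (b : m → ℂ) :
    ‖(WithLp.toLp 2 (A *ᵥ b) : EuclideanSpace ℂ m)‖ ≤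
      ‖A‖ * ‖(WithLp.toLp 2 b : EuclideanSpace ℂ m)‖ :=
  Matrix.l2_opNorm_mulVec A (WithLp.toLp 2 b)

/-- **Cauchy–Schwarz with the operator norm**: `|⟨a, A b⟩| ≤ ‖a‖₂ ‖A‖ ‖b‖₂`. [folklore] -/
theorem norm_star_dotProduct_mulVec_le (A : Matrix m m ℂ) (a b : m → ℂ) :
    ‖star a ⬝ᵥ (A *ᵥ b)‖ ≤ ‖(WithLp.toLp 2 a : EuclideanSpace ℂ m)‖ *
      (‖A‖ * ‖(WithLp.toLp 2 b : EuclideanSpace ℂ m)‖) := by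
  rw [star_dotProduct_eq_inner]
  exact (norm_inner_le_norm _ _).trans (mul_le_mul_of_nonneg_left (norm_toLp_mulVec_le A b)
    (norm_nonneg _))

omit [DecidableEq m] in
/-- `⟨a, a⟩` is real: `⟨a, a⟩ = Re ⟨a, a⟩`. [folklore] -/
theorem star_dotProduct_self_eq_re (a : m → ℂ) : star a ⬝ᵥ a = ((star a ⬝ᵥ a).re : ℂ) := by
  rw [dotProduct, Complex.re_sum]
  push_cast
  refine Finset.sum_congr rfl fun i _ => ?_
  rw [Pi.star_apply, Complex.star_def, Complex.conj_mul', ← Complex.ofReal_pow, Complex.ofReal_re]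

end Generic

section AddCost

variable {Λ : Type*} [LinearOrder Λ] [Fintype Λ] (G : SimpleGraph Λ) [DecidableRel G.Adj]

/-- **A normalised ground state exists in every sector `N ≤ 2|Λ|`**: the Hubbard Hamiltonian is
Hermitian and block diagonal in the particle number, so `sector_groundState` applies to the
coordinate subspace `nParticleSubmodule N`. [folklore] -/
theorem exists_unit_groundState (t U : ℝ) {N : ℕ} (hN : N ≤ 2 * Fintype.card Λ) :
    ∃ ψ : Fock (Orb Λ), IsNParticle N ψ ∧ star ψ ⬝ᵥ ψ = 1 ∧
      hamiltonian G t U *ᵥ ψ = ((groundEnergyAt G t U N : ℝ) : ℂ) • ψ := by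
  classical
  set H := hamiltonian G t U with hH
  have hc : N ≤ (Finset.univ : Finset (Orb Λ)).card := by rwa [Finset.card_univ, card_orb]
  obtain ⟨s₀, -, hs₀⟩ := Finset.exists_subset_card_eq hc
  have hp : ∃ s : Finset (Orb Λ), s.card = N := ⟨s₀, hs₀⟩
  have hinv : ∀ s s' : Finset (Orb Λ), ¬(s.card = N) → s'.card = N → H s s' = 0 := by
    intro s s' hs hs'
    by_contra h
    have := LiebThm1.preservesSectors_hamiltonian G t U s s' h
    apply hs
    rw [card_eq_upPart_add_downPart, this.1, this.2, ← card_eq_upPart_add_downPart, hs']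
  obtain ⟨⟨v, hv, hv0, hHv⟩, -⟩ := sector_groundState H (LiebThm1.hamiltonian_isHermitian G t U)
    (fun s : Finset (Orb Λ) => s.card = N) hp hinv (nParticleSubmodule N) (fun v => Iff.rfl)
  obtain ⟨c, -, hc1⟩ := exists_smul_unit hv0
  refine ⟨c • v, Submodule.smul_mem _ c hv, hc1, ?_⟩
  rw [mulVec_smul, hHv, smul_comm, groundEnergyAt,
    groundEnergy_eq_minEnergyOn H N (nParticleSubmodule N) fun ψ => Iff.rfl]

/-- The homogeneous variational bound `E_G(N) ⟨φ, φ⟩ ≤ Re ⟨φ, H φ⟩` on the `N`-particle sector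
(normalise `φ ≠ 0`). [folklore] -/
theorem groundEnergyAt_mul_norm_le (t U : ℝ) {N : ℕ} {φ : Fock (Orb Λ)} (hφ : IsNParticle N φ) :
    groundEnergyAt G t U N * (star φ ⬝ᵥ φ).re ≤ (expect (hamiltonian G t U) φ).re := by
  set H := hamiltonian G t U
  by_cases h0 : φ = 0
  · subst h0
    simp [expect]
  obtain ⟨c, hc0, hc1⟩ := exists_smul_unit h0
  have hmem : IsNParticle N (c • φ) := (nParticleSubmodule N).smul_mem c hφ
  have h2 : groundEnergyAt G t U N ≤ (expect H (c • φ)).re := groundEnergy_le_re_expect H hmem hc1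
  have hcc : star c * c = ((‖c‖ ^ 2 : ℝ) : ℂ) := by
    rw [Complex.star_def, Complex.conj_mul']
    push_cast
    rfl
  unfold expect at h2
  rw [mulVec_smul, star_smul, smul_dotProduct, dotProduct_smul, smul_smul, hcc, smul_eq_mul,
    Complex.re_ofReal_mul] at h2
  rw [star_smul, smul_dotProduct, dotProduct_smul, smul_smul, hcc, smul_eq_mul] at hc1
  have h1 : ‖c‖ ^ 2 * (star φ ⬝ᵥ φ).re = 1 := by
    have := congrArg Complex.re hc1
    rwa [Complex.re_ofReal_mul, Complex.one_re] at this
  have hpos : 0 < ‖c‖ ^ 2 := by positivity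
  have key : ‖c‖ ^ 2 * (groundEnergyAt G t U N * (star φ ⬝ᵥ φ).re) ≤ ‖c‖ ^ 2 * (expect H φ).re :=
    calc ‖c‖ ^ 2 * (groundEnergyAt G t U N * (star φ ⬝ᵥ φ).re)
        = groundEnergyAt G t U N * (‖c‖ ^ 2 * (star φ ⬝ᵥ φ).re) := by ring
      _ = groundEnergyAt G t U N := by rw [h1, mul_one]
      _ ≤ ‖c‖ ^ 2 * (expect H φ).re := h2
  exact le_of_mul_le_mul_left key hpos

/-- `Σ_k ⟨c†_k ψ, c†_k ψ⟩ = 2|Λ| - N` on the `N`-particle sector (`c_k c†_k = 1 - n_k`,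
`Σ_k n_k = N̂`). [folklore] -/
theorem sum_star_creation_mulVec_dotProduct {N : ℕ} {ψ : Fock (Orb Λ)} (hψN : IsNParticle N ψ)
    (hψ1 : star ψ ⬝ᵥ ψ = 1) :
    ∑ k : Orb Λ, star (creation k *ᵥ ψ) ⬝ᵥ (creation k *ᵥ ψ) =
      ((2 * Fintype.card Λ : ℕ) : ℂ) - N := by
  have hk : ∀ k : Orb Λ, star (creation k *ᵥ ψ) ⬝ᵥ (creation k *ᵥ ψ) =
      star ψ ⬝ᵥ ψ - star ψ ⬝ᵥ (numberAt k *ᵥ ψ) := by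
    intro k
    rw [star_mulVec_dotProduct, creation, conjTranspose_conjTranspose, mulVec_mulVec,
      ← creation]
    have hcar := annihilation_mul_creation_add_creation_mul_annihilation_holds (ι := Orb Λ) k k
    rw [if_pos rfl] at hcar
    rw [show annihilation k * creation k = 1 - numberAt k from by
      rw [numberAt, ← hcar, add_sub_cancel_right], sub_mulVec, one_mulVec, dotProduct_sub]
  simp_rw [hk]
  rw [Finset.sum_sub_distrib, Finset.sum_const, Finset.card_univ, card_orb, hψ1, nsmul_eq_mul,
    mul_one, ← dotProduct_sum, ← Matrix.sum_mulVec]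
  have hN : (∑ k : Orb Λ, numberAt k) *ᵥ ψ = (N : ℂ) • ψ := by
    funext s
    rw [show (∑ k : Orb Λ, numberAt k) = totalNumberOp from rfl, totalNumberOp_eq_diagonal,
      mulVec_diagonal, Pi.smul_apply, smul_eq_mul]
    by_cases hs : s.card = N
    · rw [hs]
    · rw [hψN s hs, mul_zero, mul_zero]
  rw [hN, dotProduct_smul, hψ1, smul_eq_mul, mul_one]

/-- **The one-particle addition cost.** On a graph of maximal degree `≤ Δ`, adding one particle to
an `N`-particle ground state costs on AVERAGE at most `K = 2(2Δ+1)(2|t| + |U|)` per unit weight: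
`E_G(N+1) ≤ E_G(N) + K · 2|Λ| / (2|Λ| - N)` for `N < 2|Λ|`. Proof: for a normalised sector ground
state `ψ` the `2|Λ|` trial vectors `c†_k ψ` lie in the `(N+1)`-sector, have total weight
`Σ ‖c†_k ψ‖² = 2|Λ| - N`, and `⟨c†_kψ, H c†_kψ⟩ = E ‖c†_kψ‖² + ⟨c†_kψ, [H, c†_k] ψ⟩` with
`‖[H, c†_k]‖ ≤ K` (`norm_commutator_hamiltonianWith_creation_le`). (An entropy-free, volume-
uniform Lipschitz bound in the density; Ruelle (1969) §3.4 for the classical analogue.) [folklore] -/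
theorem groundEnergyAt_succ_le {Δ : ℕ} (hΔ : ∀ x : Λ, #{y | G.Adj x y} ≤ Δ) (t U : ℝ) {N : ℕ}
    (hN : N < 2 * Fintype.card Λ) :
    groundEnergyAt G t U (N + 1) ≤ groundEnergyAt G t U N +
      (2 * Δ + 1 : ℕ) * (2 * (2 * |t| + |U|)) * (2 * Fintype.card Λ) / (2 * Fintype.card Λ - N) := by
  classical
  set H := hamiltonian G t U with hH
  set E := groundEnergyAt G t U N with hE
  set E' := groundEnergyAt G t U (N + 1) with hE'
  set K : ℝ := (2 * Δ + 1 : ℕ) * (2 * (2 * |t| + |U|)) with hK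
  obtain ⟨ψ, hψN, hψ1, hHψ⟩ := exists_unit_groundState G t U hN.le
  -- trial vectors and weights
  set φ : Orb Λ → Fock (Orb Λ) := fun k => creation k *ᵥ ψ with hφ
  set w : Orb Λ → ℝ := fun k => (star (φ k) ⬝ᵥ φ k).re with hw
  have hφN : ∀ k, IsNParticle (N + 1) (φ k) := fun k => IsNParticle.creation_mulVec_holds hψN k
  -- total weight
  have hW : ∑ k, w k = 2 * Fintype.card Λ - N := by
    have h := congrArg Complex.re (sum_star_creation_mulVec_dotProduct hψN hψ1)
    rw [Complex.re_sum] at h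
    rw [show ∑ k, w k = ∑ k : Orb Λ, (star (creation k *ᵥ ψ) ⬝ᵥ (creation k *ᵥ ψ)).re from rfl, h]
    simp
  have hWpos : (0 : ℝ) < 2 * Fintype.card Λ - N := by
    have : (N : ℝ) < (2 * Fintype.card Λ : ℕ) := by exact_mod_cast hN
    push_cast at this
    linarith
  -- energies of the trial vectors
  have hnormψ : ‖(WithLp.toLp 2 ψ : EuclideanSpace ℂ (Finset (Orb Λ)))‖ = 1 := by
    have h := norm_toLp_sq ψ
    rw [hψ1, Complex.one_re] at h
    rwa [pow_eq_one_iff_of_nonneg (norm_nonneg _) two_ne_zero] at h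
  have hnormφ : ∀ k, ‖(WithLp.toLp 2 (φ k) : EuclideanSpace ℂ (Finset (Orb Λ)))‖ ≤ 1 := by
    intro k
    calc ‖(WithLp.toLp 2 (φ k) : EuclideanSpace ℂ (Finset (Orb Λ)))‖
        ≤ ‖creation k‖ * ‖(WithLp.toLp 2 ψ : EuclideanSpace ℂ (Finset (Orb Λ)))‖ :=
          norm_toLp_mulVec_le _ _
      _ ≤ 1 * 1 := by
          gcongr
          · exact norm_creation_le_one (ι := Orb Λ) k
          · exact hnormψ.le
      _ = 1 := one_mul _
  have hcomm : ∀ k, ‖H * creation k - creation k * H‖ ≤ K := by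
    intro k
    have h := norm_commutator_hamiltonianWith_creation_le G hΔ t U 0 (ofLex k).1 (ofLex k).2
    rw [hamiltonianWith_zero, abs_zero, mul_zero, add_zero] at h
    exact h
  have hen : ∀ k, (star (φ k) ⬝ᵥ (H *ᵥ φ k)).re ≤ E * w k + K := by
    intro k
    have hsplit : H *ᵥ φ k = (E : ℂ) • φ k + (H * creation k - creation k * H) *ᵥ ψ := by
      simp only [hφ]
      rw [sub_mulVec, ← mulVec_mulVec, ← mulVec_mulVec, hHψ, mulVec_smul]
      abel
    rw [hsplit, dotProduct_add, dotProduct_smul, smul_eq_mul, Complex.add_re, Complex.re_ofReal_mul,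
      star_dotProduct_self_eq_re, Complex.ofReal_re]
    have hX : ‖star (φ k) ⬝ᵥ ((H * creation k - creation k * H) *ᵥ ψ)‖ ≤ K := by
      refine (norm_star_dotProduct_mulVec_le _ _ _).trans ?_
      rw [hnormψ, mul_one]
      calc _ ≤ 1 * K := mul_le_mul (hnormφ k) (hcomm k) (norm_nonneg _) zero_le_one
        _ = K := one_mul K
    have hX' := (Complex.re_le_norm _).trans hX
    change E * w k + _ ≤ E * w k + K
    linarith
  -- variational bound on each trial vector, summed
  have hvar : ∀ k, E' * w k ≤ (star (φ k) ⬝ᵥ (H *ᵥ φ k)).re := fun k =>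
    groundEnergyAt_mul_norm_le G t U (hφN k)
  have hsum : E' * (2 * Fintype.card Λ - N) ≤ E * (2 * Fintype.card Λ - N) + K * (2 * Fintype.card Λ) := by
    have h1 : ∑ k, E' * w k ≤ ∑ k, (E * w k + K) :=
      Finset.sum_le_sum fun k _ => (hvar k).trans (hen k)
    rw [← Finset.mul_sum, hW, Finset.sum_add_distrib, ← Finset.mul_sum, hW, Finset.sum_const,
      Finset.card_univ, card_orb, nsmul_eq_mul] at h1
    push_cast at h1
    linarith
  rw [show E + K * (2 * Fintype.card Λ) / (2 * Fintype.card Λ - N) =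
    (E * (2 * Fintype.card Λ - N) + K * (2 * Fintype.card Λ)) / (2 * Fintype.card Λ - N) by
    field_simp]
  rw [le_div_iff₀ hWpos]
  exact hsum

/-- `Σ_k ⟨c_k ψ, c_k ψ⟩ = N` on the `N`-particle sector (`Σ_k n_k = N̂`). [folklore] -/
theorem sum_star_annihilation_mulVec_dotProduct {N : ℕ} {ψ : Fock (Orb Λ)} (hψN : IsNParticle N ψ)
    (hψ1 : star ψ ⬝ᵥ ψ = 1) :
    ∑ k : Orb Λ, star (annihilation k *ᵥ ψ) ⬝ᵥ (annihilation k *ᵥ ψ) = (N : ℂ) := by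
  simp_rw [← dotProduct_creation_mul_annihilation_mulVec]
  rw [← dotProduct_sum, ← Matrix.sum_mulVec]
  have hN : (∑ k : Orb Λ, creation k * annihilation k) *ᵥ ψ = (N : ℂ) • ψ := by
    funext s
    rw [show (∑ k : Orb Λ, creation k * annihilation k) = totalNumberOp from rfl,
      totalNumberOp_eq_diagonal, mulVec_diagonal, Pi.smul_apply, smul_eq_mul]
    by_cases hs : s.card = N
    · rw [hs]
    · rw [hψN s hs, mul_zero, mul_zero]
  rw [hN, dotProduct_smul, hψ1, smul_eq_mul, mul_one]

/-- **The one-particle removal cost**: `E_G(N-1) ≤ E_G(N) + K · 2|Λ| / N` for `1 ≤ N ≤ 2|Λ|`,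
`K = 2(2Δ+1)(2|t| + |U|)` (the same averaging with the trial vectors `c_k ψ`, total weight
`Σ ‖c_k ψ‖² = N`, and `‖[H, c_k]‖ ≤ K`). [folklore] -/
theorem groundEnergyAt_pred_le {Δ : ℕ} (hΔ : ∀ x : Λ, #{y | G.Adj x y} ≤ Δ) (t U : ℝ) {N : ℕ}
    (hN1 : 1 ≤ N) (hN : N ≤ 2 * Fintype.card Λ) :
    groundEnergyAt G t U (N - 1) ≤ groundEnergyAt G t U N +
      (2 * Δ + 1 : ℕ) * (2 * (2 * |t| + |U|)) * (2 * Fintype.card Λ) / N := by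
  classical
  set H := hamiltonian G t U with hH
  set E := groundEnergyAt G t U N with hE
  set E' := groundEnergyAt G t U (N - 1) with hE'
  set K : ℝ := (2 * Δ + 1 : ℕ) * (2 * (2 * |t| + |U|)) with hK
  obtain ⟨ψ, hψN, hψ1, hHψ⟩ := exists_unit_groundState G t U hN
  -- trial vectors and weights
  set φ : Orb Λ → Fock (Orb Λ) := fun k => annihilation k *ᵥ ψ with hφ
  set w : Orb Λ → ℝ := fun k => (star (φ k) ⬝ᵥ φ k).re with hw
  have hψN' : IsNParticle (N - 1 + 1) ψ := by rwa [Nat.sub_add_cancel hN1]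
  have hφN : ∀ k, IsNParticle (N - 1) (φ k) := fun k => IsNParticle.annihilation_mulVec_holds hψN' k
  -- total weight
  have hW : ∑ k, w k = N := by
    have h := congrArg Complex.re (sum_star_annihilation_mulVec_dotProduct hψN hψ1)
    rw [Complex.re_sum] at h
    rw [show ∑ k, w k = ∑ k : Orb Λ, (star (annihilation k *ᵥ ψ) ⬝ᵥ (annihilation k *ᵥ ψ)).re
      from rfl, h]
    simp
  have hWpos : (0 : ℝ) < N := by exact_mod_cast hN1
  -- energies of the trial vectors
  have hnormψ : ‖(WithLp.toLp 2 ψ : EuclideanSpace ℂ (Finset (Orb Λ)))‖ = 1 := by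
    have h := norm_toLp_sq ψ
    rw [hψ1, Complex.one_re] at h
    rwa [pow_eq_one_iff_of_nonneg (norm_nonneg _) two_ne_zero] at h
  have hnormφ : ∀ k, ‖(WithLp.toLp 2 (φ k) : EuclideanSpace ℂ (Finset (Orb Λ)))‖ ≤ 1 := by
    intro k
    calc ‖(WithLp.toLp 2 (φ k) : EuclideanSpace ℂ (Finset (Orb Λ)))‖
        ≤ ‖annihilation k‖ * ‖(WithLp.toLp 2 ψ : EuclideanSpace ℂ (Finset (Orb Λ)))‖ :=
          norm_toLp_mulVec_le _ _
      _ ≤ 1 * 1 := by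
          gcongr
          · exact norm_annihilation_le_one (ι := Orb Λ) k
          · exact hnormψ.le
      _ = 1 := one_mul _
  have hcomm : ∀ k, ‖H * annihilation k - annihilation k * H‖ ≤ K := by
    intro k
    have h := norm_commutator_hamiltonianWith_annihilation_le G hΔ t U 0 (ofLex k).1 (ofLex k).2
    rw [hamiltonianWith_zero, abs_zero, mul_zero, add_zero] at h
    exact h
  have hen : ∀ k, (star (φ k) ⬝ᵥ (H *ᵥ φ k)).re ≤ E * w k + K := by
    intro k
    have hsplit : H *ᵥ φ k = (E : ℂ) • φ k + (H * annihilation k - annihilation k * H) *ᵥ ψ := by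
      simp only [hφ]
      rw [sub_mulVec, ← mulVec_mulVec, ← mulVec_mulVec, hHψ, mulVec_smul]
      abel
    rw [hsplit, dotProduct_add, dotProduct_smul, smul_eq_mul, Complex.add_re, Complex.re_ofReal_mul,
      star_dotProduct_self_eq_re, Complex.ofReal_re]
    have hX : ‖star (φ k) ⬝ᵥ ((H * annihilation k - annihilation k * H) *ᵥ ψ)‖ ≤ K := by
      refine (norm_star_dotProduct_mulVec_le _ _ _).trans ?_
      rw [hnormψ, mul_one]
      calc _ ≤ 1 * K := mul_le_mul (hnormφ k) (hcomm k) (norm_nonneg _) zero_le_one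
        _ = K := one_mul K
    have hX' := (Complex.re_le_norm _).trans hX
    change E * w k + _ ≤ E * w k + K
    linarith
  -- variational bound on each trial vector, summed
  have hvar : ∀ k, E' * w k ≤ (star (φ k) ⬝ᵥ (H *ᵥ φ k)).re := fun k =>
    groundEnergyAt_mul_norm_le G t U (hφN k)
  have hsum : E' * N ≤ E * N + K * (2 * Fintype.card Λ) := by
    have h1 : ∑ k, E' * w k ≤ ∑ k, (E * w k + K) :=
      Finset.sum_le_sum fun k _ => (hvar k).trans (hen k)
    rw [← Finset.mul_sum, hW, Finset.sum_add_distrib, ← Finset.mul_sum, hW, Finset.sum_const,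
      Finset.card_univ, card_orb, nsmul_eq_mul] at h1
    push_cast at h1
    linarith
  rw [show E + K * (2 * Fintype.card Λ) / N = (E * N + K * (2 * Fintype.card Λ)) / N by
    field_simp]
  rw [le_div_iff₀ hWpos]
  exact hsum

end AddCost

end ThermodynamicLimit

end Literature.MathematicalPhysics.QuantumLattice
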